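import Summits.Ventures.CertifiedArithmetic.LowPrec.GemmThetaLawSym
import Summits.Ventures.CertifiedArithmetic.LowPrec.GemmThetaE2M1Data

/-!
# The θ-certificate of E2M1² at EVERY accumulator precision `p ≥ 9`: classes and Boolean checkers

HONEST FRAMING (venture CertifiedArithmetic / cell `pub-lowprec`, seat gemm, gen 12): certified error
envelopes and provably optimal rounding/accumulation schemes for low-precision formats under stated
cost models; every table by two implementations; no hardware or vendor claims.

Paper `gemm.tex` §Regimes, Theorem t:thetap (iii): for E2M1·E2M1 products (the 37 quarter-integers
`Π = ThetaE2M1.lamQ / 4`, `|x| ≤ 36`) accumulated sequentially under round-to-nearest-even in ANY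
`p`-bit binary significand, the θ-certificate of Prop. Θ holds on the state set
`S_p = F ∩ [-2^9 M, 2^9 M]` (`M = 2^(p-1)`) with the potential `ψ_p` of the paper and the constants
`θ_p = 13·2^(p-7) + 1/4`, `ρ = 7/2`, `β_pair = 23/2`, `κ = 1/θ_p`.  The paper proves this from
finitely many `p`-free rounding rules (R1)–(R5), checked by the cell's implementation A on affine forms
in `M` and by implementation B numerically for `8 ≤ p ≤ 16`.  THIS FILE is the data of a KERNEL check
valid for every `p ≥ 9` at once, in quarter units with the symbols `H = M/2 = 2^(p-2)` and `T`
(`GemmThetaLawSym.lean`): the nonnegative magnitudes `≥ 2^p = 4H` of `S_p` are covered by 1313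
CLASSES (`Cls`) — `qh z` = `4H - z` (`1 ≤ z ≤ 144`, the top of the exact region, reached from
`|v| < 2^p`), and per binade `j ≤ 7` (unit `u_j = 2^(j+1)`, vertices `(M + t')·u_j`, `0 ≤ t' ≤ M`):
`low j t'` (`t' ≤ 71`), `mid j π` (`t' = 2T + π`, `36 ≤ T ≤ H - 37`), `high j s` (`t' = M - s`,
`1 ≤ s ≤ 72`), and the top vertex `low 8 0 = 2^9 M`; a state is `±` a class value (`σ = true` for the
negative sign, where `ψ_p(v) = |v|`).  `edgeOK σ c x` evaluates the accumulation step from the class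
under the letter `x ∈ lamQ` with the symbolic rounding `symRne` and checks closure, the potential
inequality, the capacity inequality at absorbed negative letters, `2δ ≤ 7d` on paid moves and, on free
moves (`d = 0`), `δ(13H + 8) ≤ 32 ψ` (`κ = 1/θ_p`, `32 θ_p = 13H + 8` in quarter units) together with
the shape of the target (binade `j' ≤ 6`, even significand, `δ ≤ 2^{j'}`) that keys the PAIR TABLE
`pairTableOK j'`: from every vertex of binade `j'` with even `t'` every letter is absorbed or satisfies
`2(2^{j'} + δ') ≤ 23 d'`.  All inequalities are affine in `(H, T)` and decided on the whole parameter
domain by `nonnegOn`.  The potential in quarter units: `ψ(qh z) = 4H - z`;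
`ψ((M + t')u_j) = 2B_j H + s_j ⌈t'/2⌉` (`j ≤ 6`; `B = (2,3,4,6,7,9,13)`, `s = (2,2,4,2,4,8,16)`),
`= 42H + 32t'` (`j = 7`), `ψ(2^9 M) = 106 H` [gemm.tex Thm t:thetap (ii), transcribed; the kernel
re-verifies every inequality it is used in].  `GemmThetaLawE2M1Check*.lean` run the checks by
`decide +kernel`; `GemmThetaLawE2M1Sound.lean` / `GemmThetaLawE2M1.lean` turn them into a
`ThetaCertificate` for every format of precision `p ≥ 9` whose quarter grid lies in range.
-/

namespace Literature.ComputerArithmetic.FloatingPoint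

namespace MiniFloat

namespace ThetaLawE2M1

open ThetaE2M1 (lamQ)
open ThetaLaw
open ThetaLaw.AForm (const hH smul)

/-- The unit `u_j = 2^(j+1)` of binade `j` (quarter units; binade `0` starts at `2^p = 4H`).
[gemm.tex Thm t:thetap] -/
def u (j : ℕ) : ℤ := 2 ^ (j + 1)

/-- The magnitude classes of states `≥ 2^p` (see the file header). [cell] -/
inductive Cls where
  | qh (z : ℕ)
  | low (j t : ℕ)
  | mid (j π : ℕ)
  | high (j s : ℕ)
  deriving DecidableEq, Repr

/-- Whether the class carries the free half-significand `T`. [cell] -/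
def Cls.hasT : Cls → Bool
  | Cls.mid _ _ => true
  | _ => false

/-- The magnitude of the class as a form in `(H, T)` (quarter units). [cell] -/
def Cls.valF : Cls → AForm
  | Cls.qh z => ⟨-(z : ℤ), 4, 0⟩
  | Cls.low j t => ⟨(t : ℤ) * u j, 2 * u j, 0⟩
  | Cls.mid j π => ⟨(π : ℤ) * u j, 2 * u j, 2 * u j⟩
  | Cls.high j s => ⟨-(s : ℤ) * u j, 4 * u j, 0⟩

/-- Binades to try when rounding `class ± letter`: the class's own, the one below, the one above.
[cell] -/
def Cls.hints : Cls → List ℕ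
  | Cls.qh _ => [1]
  | Cls.low j _ => (j + 1) :: (if 1 ≤ j then [j, j + 2] else [j + 2])
  | Cls.mid j _ => (j + 1) :: (if 1 ≤ j then [j, j + 2] else [j + 2])
  | Cls.high j _ => (j + 1) :: (if 1 ≤ j then [j, j + 2] else [j + 2])

/-- `2 B_j`: the `H`-coefficient of the potential at the start of binade `j ≤ 6`.
[gemm.tex Thm t:thetap (ii), transcribed] -/
def bH (j : ℕ) : ℤ := [4, 6, 8, 12, 14, 18, 26].getD j 0

/-- `s_j`: the increment of the potential at odd significands in binade `j ≤ 6`.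
[gemm.tex Thm t:thetap (ii), transcribed] -/
def sOdd (j : ℕ) : ℤ := [2, 2, 4, 2, 4, 8, 16].getD j 0

/-- The potential (quarter units) of the vertex `(M + t')·u_j` as a form, given the form `tf` of
`t'`; defined when `0 ≤ t' ≤ M = 2H` holds on the domain and the parity data are determined:
`2B_j H + s_j ⌈t'/2⌉` (`j ≤ 6`), `42H + 32 t'` (`j = 7`), `106 H` (`j = 8`, `t' = 0`). [gemm.tex
Thm t:thetap (ii)] -/
def psiBig (hasT : Bool) (j : ℕ) (tf : AForm) : Option AForm :=
  if nonnegOn hasT tf && nonnegOn hasT ((hH 2).sub tf) then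
    if j ≤ 6 then (ceilHalf tf).map fun ch => (smul (sOdd j) ch).add (hH (bH j))
    else if j = 7 then some ((smul 32 tf).add (hH 42))
    else if j = 8 then (if nonnegOn hasT ((const 0).sub tf) then some (hH 106) else none)
    else none
  else none

/-- The potential of a (nonnegative) class as a form. [cell] -/
def Cls.psiF : Cls → Option AForm
  | Cls.qh z => some ⟨-(z : ℤ), 4, 0⟩
  | Cls.low j t => psiBig false j (const t)
  | Cls.mid j π => psiBig true j ⟨π, 0, 2⟩
  | Cls.high j s => psiBig false j ⟨-(s : ℤ), 2, 0⟩

/-- The potential of a (nonnegative) rounding target as a form: a `big e sig` target is the vertex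
`sig · 2^e` of binade `e - 1` with `t' = sig - 2H`; a `small` target is exact, `ψ = |v|`. [cell] -/
def psiTgt (hasT : Bool) : Tgt → Option AForm
  | Tgt.big e sig => if e = 0 then none else psiBig hasT (e - 1) (sig.sub (hH 2))
  | Tgt.small n => some n

/-- SHAPE OF A FREE-MOVE TARGET keyed to the pair table: binade `e - 1 ≤ 6`, gain `δ ≤ 2^(e-1)`,
and an even significand whose parity is determined (`t'`-form with even coefficients). [cell] -/
def freeTgtOK (tg : Tgt) (δ : ℤ) : Bool :=
  match tg with
  | Tgt.big e sig =>
      decide (1 ≤ e) && decide (e ≤ 7) && decide (δ ≤ 2 ^ (e - 1)) &&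
        decide ((sig.sub (hH 2)).a % 2 = 0) && decide ((sig.sub (hH 2)).b % 2 = 0) &&
        decide ((sig.sub (hH 2)).c % 2 = 0)
  | Tgt.small _ => false

/-- CLOSURE SHAPE of a rounding target: binade index `1 ≤ e ≤ 8` (a vertex `(M + t')u_{e-1}`,
`t' ≤ M`), or `e = 9` with significand exactly `M` (the top vertex `2^9 M`); exact targets are
always states. [cell] -/
def tgtOK (hasT : Bool) : Tgt → Bool
  | Tgt.big e sig =>
      decide (1 ≤ e) && (decide (e ≤ 8) || (decide (e = 9) && nonnegOn hasT ((hH 2).sub sig)))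
  | Tgt.small _ => true

/-- Sign action: `sgnZ σ a = -a` for the negative sign `σ = true`, else `a`. [cell] -/
def sgnZ (σ : Bool) (a : ℤ) : ℤ := if σ then -a else a

/-- The magnitude form `|v| ± x` of `v + x` for the state `v = ±c` (`σ = true`: `v = -c`, and then
`v + x = -(|v| - x)`). [cell] -/
def nF (σ : Bool) (c : Cls) (x : ℤ) : AForm :=
  if σ then c.valF.sub (const x) else c.valF.add (const x)

/-- The potential form of the state `±c`: `|v|` for negative states. [cell] -/
def psiV (σ : Bool) (c : Cls) : Option AForm := if σ then some c.valF else c.psiF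

/-- The potential form of the new state `±(target)`: its magnitude for negative states. [cell] -/
def psiW (σ : Bool) (hasT : Bool) (tg : Tgt) : Option AForm :=
  if σ then some tg.val else psiTgt hasT tg

/-- THE CHECKS OF ONE EDGE, given the rounding target and the two potential forms (quarter units;
`32 θ_p = 13H + 8`): the rounding offset is a constant `δ` (gain `δ = fl(v+x) - (v+x)`, deficit
`d = |x| - δ`) and the target is a state (`tgtOK`); at an absorption (`δ = -x`) of a negative letter
the capacity inequality `(13H + 8)|x| ≤ 32 ψ(v)`; at a move the potential inequality
`ψ(w) ≤ ψ(v) + d`, `2δ ≤ 7d` if paid (`d > 0`), and if free (`d = 0`) `(13H + 8) δ ≤ 32 ψ(v)` and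
`freeTgtOK`. [cell, gemm.tex §Regimes Prop. Θ and Thm t:thetap] -/
def edgeBody (σ : Bool) (c : Cls) (x : ℤ) (tg : Tgt) (ψv ψw : AForm) : Bool :=
  let dl := tg.val.sub (nF σ c x)
  let δ := sgnZ σ dl.a
  let d := (x.natAbs : ℤ) - δ
  decide (dl.b = 0) && decide (dl.c = 0) && tgtOK c.hasT tg &&
  (if δ = -x then
    decide (0 ≤ x) || nonnegOn c.hasT ((smul 32 ψv).sub (smul (x.natAbs : ℤ) ⟨8, 13, 0⟩))
   else
    nonnegOn c.hasT ((ψv.add (const d)).sub ψw) &&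
    (if 0 < d then decide (2 * δ ≤ 7 * d)
     else decide (d = 0) && nonnegOn c.hasT ((smul 32 ψv).sub (smul δ ⟨8, 13, 0⟩)) &&
       freeTgtOK tg δ))

/-- EDGE CHECK of the state `±c` (`σ = true`: negative) under the letter `x`: round `|v| ± x`
symbolically, look up the two potential forms, run `edgeBody`. [cell] -/
def edgeOK (σ : Bool) (c : Cls) (x : ℤ) : Bool :=
  match symRne c.hasT c.hints (nF σ c x) with
  | none => false
  | some tg =>
    match psiV σ c, psiW σ c.hasT tg with
    | some ψv, some ψw => edgeBody σ c x tg ψv ψw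
    | _, _ => false

/-- CLASS CHECK: every letter, both signs. [cell] -/
def clsOK (c : Cls) : Bool :=
  lamQ.all fun x => edgeOK false c x && edgeOK true c x

/-- The classes `qh z`, `z ∈ [a, a + l)`. [cell] -/
def qhOK (a l : ℕ) : Bool := (List.range' a l).all fun z => clsOK (Cls.qh z)

/-- The classes `low j t'`, `t' ∈ [a, a + l)`. [cell] -/
def lowOK (j a l : ℕ) : Bool := (List.range' a l).all fun t => clsOK (Cls.low j t)

/-- The classes `mid j 0`, `mid j 1`, `j ≤ 7`. [cell] -/
def midOK : Bool := (List.range 8).all fun j => clsOK (Cls.mid j 0) && clsOK (Cls.mid j 1)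

/-- The classes `high j s`, `s ∈ [a, a + l)`. [cell] -/
def highOK (j a l : ℕ) : Bool := (List.range' a l).all fun s => clsOK (Cls.high j s)

/-- PAIR-TABLE EDGE CHECK: from the state `±c` the letter `x` is absorbed or satisfies
`2(2^{j'} + δ') ≤ 23 d'`. [cell, gemm.tex Lemma "moving walks"] -/
def pairBody (σ : Bool) (jp : ℕ) (c : Cls) (x : ℤ) (tg : Tgt) : Bool :=
  let dl := tg.val.sub (nF σ c x)
  let δ := sgnZ σ dl.a
  decide (dl.b = 0) && decide (dl.c = 0) &&
    (decide (δ = -x) || decide (2 * (2 ^ jp + δ) ≤ 23 * ((x.natAbs : ℤ) - δ)))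

/-- PAIR-TABLE EDGE CHECK with the symbolic rounding. [cell] -/
def pairEdgeOK (σ : Bool) (jp : ℕ) (c : Cls) (x : ℤ) : Bool :=
  match symRne c.hasT c.hints (nF σ c x) with
  | none => false
  | some tg => pairBody σ jp c x tg

/-- The vertices of binade `j'` with EVEN `t'`, as classes: `t' ≤ 70`, `72 ≤ t' = 2T ≤ M - 74`,
`t' = M - s` (`2 ≤ s ≤ 72` even), and `t' = M` (the first vertex of the next binade). [cell] -/
def succList (jp : ℕ) : List Cls :=
  ((List.range 36).map fun i => Cls.low jp (2 * i)) ++ [Cls.mid jp 0] ++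
    ((List.range 36).map fun i => Cls.high jp (2 * i + 2)) ++ [Cls.low (jp + 1) 0]

/-- PAIR TABLE of binade `j'`: every letter from every even vertex, both signs. [cell] -/
def pairTableOK (jp : ℕ) : Bool :=
  (succList jp).all fun c => lamQ.all fun x => pairEdgeOK false jp c x && pairEdgeOK true jp c x

/-- Range checks concatenate (explicit lengths). [folklore] -/
theorem all_range'_append {f : ℕ → Bool} (a l₁ l₂ : ℕ)
    (h₁ : (List.range' a l₁).all f = true) (h₂ : (List.range' (a + l₁) l₂).all f = true) :
    (List.range' a (l₁ + l₂)).all f = true := by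
  rw [List.all_eq_true] at h₁ h₂ ⊢
  intro i hi
  rw [List.mem_range'_1] at hi
  by_cases h : i < a + l₁
  · exact h₁ i (List.mem_range'_1.mpr ⟨hi.1, h⟩)
  · exact h₂ i (List.mem_range'_1.mpr ⟨not_lt.mp h, by omega⟩)

/-- Sanity (and a unit of kernel time): the class `4H - 4` passes — e.g. `+ 9` rounds `4H + 5` to
`4H + 4` (`δ = -1`, `d = 10`, potential `4H + 2 ≤ 4H - 4 + 10`). [cell, kernel-checked] -/
theorem clsOK_qh_4 : clsOK (Cls.qh 4) = true := by
  decide +kernel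

end ThetaLawE2M1

end MiniFloat

end Literature.ComputerArithmetic.FloatingPoint
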